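import Mathlib
import Summits.Ventures.PercRepro2.TwoHullMaster
import Summits.Ventures.PercRepro2.SwPath

/-!
# The runs of a path word and the interface involution (blind cell PercRepro2, night-4 g39,
2026-08-29; proofs/NIGHT4-G39.md §7) — part I of (MM) on a path

On the path `p 0 – p 1 – ⋯ – p k` the hull pair of `p 0` is (the red prefix run, the blue prefix
run) and the hull pair of `p k` is (the red suffix run, the blue suffix run) (`hullPair_zero`,
`hullPair_last`, from the cluster lemmas of SwPath.lean); `p k ∉ H_{p 0}` iff the word is not
constant (`last_notMem_hull_iff`).  THE INTERFACE INVOLUTION `flipHead` complements the first run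
together with the edge right after it (the edges `i` all of whose predecessors agree, `InHead`);
at the first mismatch `r` of a non-constant word (`exists_first_mismatch`) this is exactly the
edges `≤ r`, so `flipHead` is an involution (`flipHead_flipHead`) of the non-constant words
(`not_isConst_flipHead`) which MIRRORS the prefix runs (`pre_flipHead_iff`) and acts on the suffix
runs by the shape of the tail after `r`: unchanged when the tail is not constant
(`suf_flipHead_iff_of_not_tail`), the run of the first colour grows when the tail has that colour
(`suf_mono_of_tail_first`, the other run empty on both sides), the run of the mismatch colour
shrinks when the tail has that colour (`suf_anti_of_tail_mismatch`), and the runs mirror when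
`r` is the last edge (`suf_flipHead_iff_of_last`).  Part II (TwoHullMasterPath.lean) turns this
into `Φ ζ + Φ (flipHead ζ) ≤ 0` and the count inequality.
-/

namespace Summit.Ventures.PercRepro2

namespace Path2

open Hull LocRows

open scoped Classical

variable {V : Type*} {k : ℕ}

/-! ## §1 Runs: prefixes, suffixes, the head -/

/-- All edges before the vertex `v` have the colour `b`. -/
def Pre (ζ : Config (Fin k)) (b : Bool) (v : Fin (k + 1)) : Prop := ∀ i : Fin k, (i : ℕ) < v → ζ i = b

/-- All edges from the vertex `v` on have the colour `b`. -/
def Suf (ζ : Config (Fin k)) (b : Bool) (v : Fin (k + 1)) : Prop := ∀ i : Fin k, (v : ℕ) ≤ i → ζ i = b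

/-- The edge `i` lies in the first run or is the edge right after it: the edges before `i` all
agree. -/
def InHead (ζ : Config (Fin k)) (i : Fin k) : Prop := ∀ j j' : Fin k, j < i → j' < i → ζ j = ζ j'

/-- **The interface involution**: complement the first run together with the edge after it. -/
noncomputable def flipHead (ζ : Config (Fin k)) : Config (Fin k) :=
  fun i => if InHead ζ i then !ζ i else ζ i

/-- A word is constant. -/
def IsConst (ζ : Config (Fin k)) : Prop := ∀ j j' : Fin k, ζ j = ζ j'

/-- `RedPrefix` is the red prefix run. -/
lemma RedPrefix_iff_Pre (ζ : Config (Fin k)) (v : Fin (k + 1)) : RedPrefix ζ v ↔ Pre ζ true v :=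
  Iff.rfl

/-- `RedSuffix` is the red suffix run. -/
lemma RedSuffix_iff_Suf (ζ : Config (Fin k)) (v : Fin (k + 1)) : RedSuffix ζ v ↔ Suf ζ true v :=
  Iff.rfl

/-- The red prefix run of the blue colouring is the blue prefix run. -/
lemma Pre_blue_iff (ζ : Config (Fin k)) (v : Fin (k + 1)) : Pre (blue ζ) true v ↔ Pre ζ false v := by
  simp only [Pre, blue_apply, Bool.not_eq_true']

/-- The red suffix run of the blue colouring is the blue suffix run. -/
lemma Suf_blue_iff (ζ : Config (Fin k)) (v : Fin (k + 1)) : Suf (blue ζ) true v ↔ Suf ζ false v := by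
  simp only [Suf, blue_apply, Bool.not_eq_true']

/-- `InHead` is downward closed. -/
lemma InHead.mono {ζ : Config (Fin k)} {i j : Fin k} (hj : j ≤ i) (h : InHead ζ i) : InHead ζ j :=
  fun a b ha hb => h a b (lt_of_lt_of_le ha hj) (lt_of_lt_of_le hb hj)

/-- **The first mismatch** of a non-constant word: an edge `r` whose predecessors all agree with
each other and which differs from one of them. -/
lemma exists_first_mismatch {ζ : Config (Fin k)} (h : ¬ IsConst ζ) :
    ∃ r : Fin k, InHead ζ r ∧ ∃ j, j < r ∧ ζ j ≠ ζ r := by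
  have hne : (Finset.univ.filter fun i : Fin k => ∃ j, j < i ∧ ζ j ≠ ζ i).Nonempty := by
    simp only [IsConst, not_forall] at h
    obtain ⟨a, b, hab⟩ := h
    rcases lt_trichotomy a b with hlt | heq | hgt
    · exact ⟨b, by simp only [Finset.mem_filter, Finset.mem_univ, true_and]; exact ⟨a, hlt, hab⟩⟩
    · exact absurd (by rw [heq]) hab
    · exact ⟨a, (by simp only [Finset.mem_filter, Finset.mem_univ, true_and]; exact ⟨b, hgt, Ne.symm hab⟩)⟩
  obtain ⟨r, hr, hmin⟩ := Finset.exists_min_image _ id hne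
  simp only [Finset.mem_filter, Finset.mem_univ, true_and] at hr
  refine ⟨r, ?_, hr⟩
  intro a b ha hb
  by_contra hab
  rcases lt_trichotomy a b with hlt | heq | hgt
  · have := hmin b (by simp only [Finset.mem_filter, Finset.mem_univ, true_and]; exact ⟨a, hlt, hab⟩)
    simp only [id] at this
    exact absurd hb (not_lt.2 this)
  · exact hab (by rw [heq])
  · have := hmin a (by simp only [Finset.mem_filter, Finset.mem_univ, true_and]; exact ⟨b, hgt, Ne.symm hab⟩)
    simp only [id] at this
    exact absurd ha (not_lt.2 this)

/-- At the first mismatch `r`, the head is exactly `{i ∣ i ≤ r}`. -/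
lemma inHead_iff_le {ζ : Config (Fin k)} {r : Fin k} (hr : InHead ζ r) {j : Fin k} (hj : j < r)
    (hne : ζ j ≠ ζ r) (i : Fin k) : InHead ζ i ↔ i ≤ r := by
  constructor
  · intro hi
    by_contra hlt
    have hlt' : r < i := not_le.1 hlt
    exact hne (hi j r (hj.trans hlt') hlt')
  · intro hi
    exact hr.mono hi

/-- The first edge and the mismatch: before `r` everything has the colour of the first edge. -/
lemma eq_of_lt_first {ζ : Config (Fin k)} {r : Fin k} (hr : InHead ζ r) {a b : Fin k} (ha : a < r)
    (hb : b < r) : ζ a = ζ b :=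
  hr a b ha hb

/-- **`flipHead` is an involution.** -/
theorem flipHead_flipHead (ζ : Config (Fin k)) : flipHead (flipHead ζ) = ζ := by
  by_cases hc : IsConst ζ
  · -- a constant word: every edge is in the head, everything is complemented twice
    have hall : ∀ i, InHead ζ i := fun i a b _ _ => hc a b
    have hall' : ∀ i, InHead (flipHead ζ) i := by
      intro i a b _ _
      simp only [flipHead, hall a, hall b, if_true, hc a b]
    funext i
    simp only [flipHead, hall i, hall' i, if_true, Bool.not_not]
  · obtain ⟨r, hr, j, hj, hne⟩ := exists_first_mismatch hc
    have hhead : ∀ i, InHead ζ i ↔ i ≤ r := inHead_iff_le hr hj hne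
    -- the head of the flipped word is the same
    have hr' : InHead (flipHead ζ) r := by
      intro a b ha hb
      simp only [flipHead, (hhead a).2 ha.le, (hhead b).2 hb.le, if_true, hr a b ha hb]
    have hne' : flipHead ζ j ≠ flipHead ζ r := by
      simp only [flipHead, (hhead j).2 hj.le, (hhead r).2 le_rfl, if_true]
      intro h'
      exact hne (Bool.not_inj h')
    have hhead' : ∀ i, InHead (flipHead ζ) i ↔ i ≤ r := inHead_iff_le hr' hj hne'
    funext i
    simp only [flipHead]
    by_cases hi : i ≤ r
    · simp only [(hhead i).2 hi, (hhead' i).2 hi, if_true, Bool.not_not]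
    · simp only [(hhead i).not.2 hi, (hhead' i).not.2 hi, if_false]

/-- `flipHead` preserves non-constancy. -/
lemma not_isConst_flipHead {ζ : Config (Fin k)} (h : ¬ IsConst ζ) : ¬ IsConst (flipHead ζ) := by
  obtain ⟨r, hr, j, hj, hne⟩ := exists_first_mismatch h
  have hhead : ∀ i, InHead ζ i ↔ i ≤ r := inHead_iff_le hr hj hne
  intro hc
  have := hc j r
  simp only [flipHead, (hhead j).2 hj.le, (hhead r).2 le_rfl, if_true] at this
  exact hne (Bool.not_inj this)

/-! ## §2 The hull pairs of the ends of the path -/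

variable {p : Fin (k + 1) → V}

/-- The vertices of the path selected by a predicate on positions. -/
def pathSet (p : Fin (k + 1) → V) (P : Fin (k + 1) → Prop) : Set V := {x | ∃ v, x = p v ∧ P v}

/-- `pathSet` is monotone in the predicate. -/
lemma pathSet_mono {P P' : Fin (k + 1) → Prop} (h : ∀ v, P v → P' v) : pathSet p P ⊆ pathSet p P' := by
  rintro x ⟨v, rfl, hv⟩
  exact ⟨v, rfl, h v hv⟩

/-- `pathSet` respects equivalent predicates. -/
lemma pathSet_congr {P P' : Fin (k + 1) → Prop} (h : ∀ v, P v ↔ P' v) : pathSet p P = pathSet p P' :=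
  Set.Subset.antisymm (pathSet_mono fun v => (h v).1) (pathSet_mono fun v => (h v).2)

/-- The hull pair of `p 0`: the red prefix run and the blue prefix run. -/
lemma hullPair_zero (hp : Function.Injective p) (ζ : Config (Fin k)) :
    hullPair (pathEnds p) ζ (p 0) = (pathSet p (Pre ζ true), pathSet p (Pre ζ false)) := by
  simp only [hullPair]
  congr 1
  · ext x; rw [mem_cluster_zero_iff hp]; rfl
  · ext x
    rw [mem_cluster_zero_iff hp]
    simp only [pathSet, Set.mem_setOf_eq, RedPrefix_iff_Pre, Pre_blue_iff]

/-- The hull pair of `p k`: the red suffix run and the blue suffix run. -/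
lemma hullPair_last (hp : Function.Injective p) (ζ : Config (Fin k)) :
    hullPair (pathEnds p) ζ (p (Fin.last k)) = (pathSet p (Suf ζ true), pathSet p (Suf ζ false)) := by
  simp only [hullPair]
  congr 1
  · ext x; rw [mem_cluster_last_iff hp]; rfl
  · ext x
    rw [mem_cluster_last_iff hp]
    simp only [pathSet, Set.mem_setOf_eq, RedSuffix_iff_Suf, Suf_blue_iff]

/-- `p k ∉ H_{p 0}` iff the word is not constant. -/
lemma last_notMem_hull_iff (hp : Function.Injective p) (ζ : Config (Fin k)) :
    p (Fin.last k) ∉ hull (pathEnds p) ζ (p 0) ↔ ¬ IsConst ζ := by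
  rw [mem_hull_iff, p_mem_cluster_zero_iff hp, mem_cluster_zero_iff hp]
  simp only [RedPrefix, Fin.val_last, Fin.is_lt, forall_true_left]
  constructor
  · intro h hc
    apply h
    by_cases h0 : ∀ i : Fin k, ζ i = true
    · exact Or.inl h0
    · right
      refine ⟨Fin.last k, rfl, fun i _ => ?_⟩
      simp only [blue_apply, Bool.not_eq_true']
      obtain ⟨i₀, hi₀⟩ := not_forall.1 h0
      rw [hc i i₀]
      simpa using hi₀
  · rintro hc (h | ⟨v, hv, hpre⟩)
    · exact hc fun a b => by rw [h a, h b]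
    · have hv' : Fin.last k = v := hp hv
      subst hv'
      apply hc
      intro a b
      have ha := hpre a (by simp [Fin.val_last, Fin.is_lt])
      have hb := hpre b (by simp [Fin.val_last, Fin.is_lt])
      simp only [blue_apply, Bool.not_eq_true'] at ha hb
      rw [ha, hb]

/-! ## §3 The effect of `flipHead` on the runs -/

section Mismatch

variable {ζ : Config (Fin k)} {r : Fin k} (hr : InHead ζ r) {j₀ : Fin k} (hj₀ : j₀ < r)
  (hne : ζ j₀ ≠ ζ r)
include hr hj₀ hne

/-- Before the first mismatch the colour is `!ζ r`. -/
lemma eq_not_of_lt {i : Fin k} (hi : i < r) : ζ i = !ζ r := by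
  have := hr i j₀ hi hj₀
  rw [this]
  cases h₁ : ζ j₀ <;> cases h₂ : ζ r <;> simp_all

/-- The value of `flipHead` at an index: complemented up to `r`, unchanged after. -/
lemma flipHead_apply_le {i : Fin k} (hi : i ≤ r) : flipHead ζ i = !ζ i := by
  simp only [flipHead, (inHead_iff_le hr hj₀ hne i).2 hi, if_true]

/-- After the first mismatch `flipHead` keeps the colour. -/
lemma flipHead_apply_gt {i : Fin k} (hi : r < i) : flipHead ζ i = ζ i := by
  simp only [flipHead, (inHead_iff_le hr hj₀ hne i).not.2 (not_le.2 hi), if_false]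

/-- **The prefix runs mirror under `flipHead`.** -/
theorem pre_flipHead_iff (b : Bool) (v : Fin (k + 1)) : Pre (flipHead ζ) b v ↔ Pre ζ (!b) v := by
  constructor
  · intro h i hi
    by_cases hir : i ≤ r
    · have := h i hi
      rw [flipHead_apply_le hr hj₀ hne hir] at this
      rw [← this, Bool.not_not]
    · exfalso
      have hri : r < i := not_le.1 hir
      have hj₀v : (j₀ : ℕ) < v := by have := Fin.lt_def.1 (hj₀.trans hri); omega
      have hrv : (r : ℕ) < v := by have := Fin.lt_def.1 hri; omega
      have h1 := h j₀ hj₀v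
      have h2 := h r hrv
      rw [flipHead_apply_le hr hj₀ hne hj₀.le] at h1
      rw [flipHead_apply_le hr hj₀ hne le_rfl] at h2
      exact hne (Bool.not_inj (h1.trans h2.symm))
  · intro h i hi
    by_cases hir : i ≤ r
    · rw [flipHead_apply_le hr hj₀ hne hir, h i hi, Bool.not_not]
    · exfalso
      have hri : r < i := not_le.1 hir
      have hj₀v : (j₀ : ℕ) < v := by have := Fin.lt_def.1 (hj₀.trans hri); omega
      have hrv : (r : ℕ) < v := by have := Fin.lt_def.1 hri; omega
      have h1 := h j₀ hj₀v
      have h2 := h r hrv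
      exact hne (h1.trans h2.symm)

end Mismatch

/-! ## §4 The suffix runs under `flipHead` -/

/-- The tail after `r` has the colour `d`. -/
def Tail (ζ : Config (Fin k)) (r : Fin k) (d : Bool) : Prop := ∀ i : Fin k, r < i → ζ i = d

section Suffix

variable {ζ : Config (Fin k)} {r : Fin k} (hr : InHead ζ r) {j₀ : Fin k} (hj₀ : j₀ < r)
  (hne : ζ j₀ ≠ ζ r)
include hr hj₀ hne

/-- **Interior**: the tail is not constant, the suffix runs are unchanged. -/
lemma suf_flipHead_iff_of_not_tail (hT : ∀ d, ¬ Tail ζ r d) (b : Bool) (v : Fin (k + 1)) :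
    Suf (flipHead ζ) b v ↔ Suf ζ b v := by
  constructor
  · intro h
    by_cases hvr : (r : ℕ) < v
    · intro i hi
      rw [← flipHead_apply_gt hr hj₀ hne (Fin.lt_def.2 (by omega))]
      exact h i hi
    · exfalso
      apply hT b
      intro i hi
      rw [← flipHead_apply_gt hr hj₀ hne hi]
      exact h i (by have := Fin.lt_def.1 hi; omega)
  · intro h
    by_cases hvr : (r : ℕ) < v
    · intro i hi
      rw [flipHead_apply_gt hr hj₀ hne (Fin.lt_def.2 (by omega))]
      exact h i hi
    · exfalso
      apply hT b
      intro i hi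
      exact h i (by have := Fin.lt_def.1 hi; omega)

/-- The suffix run of the colour `!ζ r` of the first run grows (the run of `ζ` is contained in the
run of the flipped word) — it is used when the tail has that colour. -/
lemma suf_mono_of_tail_first (v : Fin (k + 1)) (h : Suf ζ (!ζ r) v) :
    Suf (flipHead ζ) (!ζ r) v := by
  have hvr : (r : ℕ) < v := by
    by_contra hle
    have := h r (by omega)
    cases ζ r <;> simp at this
  intro i hi
  rw [flipHead_apply_gt hr hj₀ hne (Fin.lt_def.2 (by omega))]
  exact h i hi

/-- With a nonempty tail of the colour `!ζ r`, the suffix run of the colour `ζ r` is unchanged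
(both are empty). -/
lemma suf_flipHead_iff_of_tail_first (hT : Tail ζ r (!ζ r)) {i₁ : Fin k} (hi₁ : r < i₁)
    (v : Fin (k + 1)) : Suf (flipHead ζ) (ζ r) v ↔ Suf ζ (ζ r) v := by
  have hi₁c : ζ i₁ = !ζ r := hT i₁ hi₁
  constructor
  · intro h i hi
    exfalso
    have hv : (i₁ : ℕ) < v := by
      by_contra hle
      have := h i₁ (by omega)
      rw [flipHead_apply_gt hr hj₀ hne hi₁, hi₁c] at this
      cases ζ r <;> simp at this
    have hir : r < i := Fin.lt_def.2 (by have := Fin.lt_def.1 hi₁; omega)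
    have := h i hi
    rw [flipHead_apply_gt hr hj₀ hne hir, hT i hir] at this
    cases ζ r <;> simp at this
  · intro h i hi
    exfalso
    have hv : (i₁ : ℕ) < v := by
      by_contra hle
      have := h i₁ (by omega)
      rw [hi₁c] at this
      cases ζ r <;> simp at this
    have hir : r < i := Fin.lt_def.2 (by have := Fin.lt_def.1 hi₁; omega)
    have := h i hi
    rw [hT i hir] at this
    cases ζ r <;> simp at this

/-- The suffix run of the colour `ζ r` of the mismatch edge shrinks (the run of the flipped word
is contained in the run of `ζ`) — it is used when the tail has that colour. -/
lemma suf_anti_of_tail_mismatch (v : Fin (k + 1))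
    (h : Suf (flipHead ζ) (ζ r) v) : Suf ζ (ζ r) v := by
  have hvr : (r : ℕ) < v := by
    by_contra hle
    have := h r (by omega)
    rw [flipHead_apply_le hr hj₀ hne le_rfl] at this
    cases ζ r <;> simp at this
  intro i hi
  rw [← flipHead_apply_gt hr hj₀ hne (Fin.lt_def.2 (by omega))]
  exact h i hi

/-- With a nonempty tail of the colour `ζ r`, the suffix run of the colour `!ζ r` is unchanged
(both are empty). -/
lemma suf_flipHead_iff_of_tail_mismatch (hT : Tail ζ r (ζ r)) {i₁ : Fin k} (hi₁ : r < i₁)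
    (v : Fin (k + 1)) : Suf (flipHead ζ) (!ζ r) v ↔ Suf ζ (!ζ r) v := by
  have hi₁c : ζ i₁ = ζ r := hT i₁ hi₁
  constructor
  · intro h i hi
    exfalso
    have hv : (i₁ : ℕ) < v := by
      by_contra hle
      have := h i₁ (by omega)
      rw [flipHead_apply_gt hr hj₀ hne hi₁, hi₁c] at this
      cases ζ r <;> simp at this
    have hir : r < i := Fin.lt_def.2 (by have := Fin.lt_def.1 hi₁; omega)
    have := h i hi
    rw [flipHead_apply_gt hr hj₀ hne hir, hT i hir] at this
    cases ζ r <;> simp at this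
  · intro h i hi
    exfalso
    have hv : (i₁ : ℕ) < v := by
      by_contra hle
      have := h i₁ (by omega)
      rw [hi₁c] at this
      cases ζ r <;> simp at this
    have hir : r < i := Fin.lt_def.2 (by have := Fin.lt_def.1 hi₁; omega)
    have := h i hi
    rw [hT i hir] at this
    cases ζ r <;> simp at this

/-- **Empty tail** (`r` is the last edge): the suffix runs mirror. -/
lemma suf_flipHead_iff_of_last (hlast : ∀ i : Fin k, ¬ r < i) (b : Bool) (v : Fin (k + 1)) :
    Suf (flipHead ζ) b v ↔ Suf ζ (!b) v := by
  constructor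
  · intro h i hi
    have := h i hi
    rw [flipHead_apply_le hr hj₀ hne (not_lt.1 (hlast i))] at this
    rw [← this, Bool.not_not]
  · intro h i hi
    rw [flipHead_apply_le hr hj₀ hne (not_lt.1 (hlast i)), h i hi, Bool.not_not]

end Suffix

end Path2

end Summit.Ventures.PercRepro2
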